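import Summits.HodgeConjecture.HodgeConjecture.Theorems.R90S4TwistedTubeFibres              -- ★ (B1-T) part 2a (R90-C131-p03): (LI), (FC), equivariance/continuity, twisted-Weyl separation `exists_normWindow_injOn_epsTube`; brings ★ part 1 (`epsNorm_sheet`, `lintegral_sheetMeasure`, …)
import Summits.HodgeConjecture.HodgeConjecture.Theorems.R90S4EquivariantFamilyTubeJacobian     -- ★ p864154 M2♭ (R90-C131-p03): `integrable_and_integral_eq_of_tubeJacobian_local` (brings ★ M2 p864068, ★ FibreCountPullback `measurableSet_image_inter_of_locallyInjOn`)
import Summits.HodgeConjecture.HodgeConjecture.Theorems.R90S4CartanMeasures                    -- ★ `cartanWeight`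
import HarnessLib

/-!
# R90-TF · S4 «Ch. 13.1–2», T-WIF road, (B1-T) part 2b′ — THE LOCAL TWISTED JACOBIAN LETTER (3′) FEEDS ★ M2♭: the local tube Jacobian over the sheeted transversal and
# THE BOCHNER RADIAL IDENTITY ON `B₀`, hypothesis-first in the (3′) letter (Rogawski 1990, §12.5 p. 186)

Cell `hodgecm-mathlib`, crux H413 (`stmt-HodgeConjecture-24833`, lane `--supports … --as helper`), route of record `HCCMUnconditional` (no route verbs;
count-neutral).  Programme R90-TF, section S4 = [Rogawski1990] Ch. 13.1–13.2; dealer K2E2-plan (g8), S4-R58 (2026-09-05T02:59:28Z): «the (3′) road is built BESIDE part 2b»;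
seat K2E3-p12 (g11).  This file is R90-C131-p03 (g3)'s part 2b `R90S4TwistedTubeRadial` (§1 `hJac_sheet_to_radial`, §2 `integrable_and_integral_epsTube_eq_of_sheetJacobian`)
with the INPUT letter (J̃♭)-(3) replaced by the LOCAL letter (3′) `hJacL` and the SAME conclusions; every carrier is spelled exactly as there.  THEOREMS ONLY — no `def`, no
instance, no notation, no named-fact hypothesis, no `sorry`; ★-only imports (★ part 2a, ★ M2♭, ★ `cartanWeight`).

HONEST LABEL: HC_CM is proved only modulo the 7 printed citations (2 remaining named inputs: hLiu418 = stmt-HodgeConjecture-24832, h413 =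
stmt-HodgeConjecture-24833) until rung 0 closes.  CONDITIONAL on the letters (L2) (Borel norm section `s`), the `K_T`-representatives `R`, the weight reading `Wt`, and (3′) (the LOCAL
twisted tube Jacobian, hypothesis `hJacL`) — all hypotheses; discharges no socket (REL ≠ ★ ≠ BUILT).

## The mathematics

SETTING as in parts 1∕2a (`Φ₃ = splitFormGL L`, `v` non-split; `T = Z_{G_v}(γ₀)`, `T̃ = Cent_{G̃_v}(γ₀)`, ε-regular base point `δ₀ ∈ T̃`, `T′ = G̃_{δ₀ε}` with a Haar measure `τ′`,
`μ₀ := νGt ∕ τ′` on `G̃_v ⧸ T′` (★ `quotientMeasure`), `Ψ(xT′, b) = x b ε(x)⁻¹`, `Ñ^ε_T` via `hN'`, `w_T = [Ñ^ε_T : T̃]`, norm section `s`, representatives `R`, sheeted transversal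
`B₀ = ⋃_{u ∈ R} s(T^{reg}) u`, `D = {(q, b) | b ∈ B₀}`), a σ-finite measure `t_T` on `T`, the SHEET MEASURE `λ := Σ_{u ∈ R} (t ↦ s t · u)_*(t_T|_{T^{reg}})` on `T̃` (part 1 §3), and a Borel
weight `Wt` on `T̃` reading ★ `cartanWeight T` through the sheets (`Wt (s t · u) = cartanWeight T t`, hypothesis `hWt`).
* §1′ THE LOCAL LETTER (3′) ⇒ ★ M2♭'s `hJac` ON `S = T̃`, `S₀ = B₀`, `lam = λ`, `W = Wt`.  THE LETTER `hJacL` (bytes of record, S4-R58): for every `b₁ ∈ B₀` an open `U′ ∋ b₁` IN `T̃` and a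
  Borel `A₀ ⊆ G̃_v ⧸ T′` with `0 < μ₀(A₀) < ⊤` such that FOR EVERY SHEET `u ∈ R` and every Borel `V ⊆ T^{reg}` WITH `s(V)·u ⊆ U′`: `νGt(Ψ(A₀ × s(V)·u)) = μ₀(A₀) · ∫⁻_V D_T dt_T`
  (`D_T = cartanWeight T`; p. 186 «`D_G(N(δ))² dδ`», sheet by sheet and LOCALLY in `T̃` — the letter ★ W-LOC ∕ WL2 + DATUM pay box by box; NO injectivity clause — part 2a's separation
  pays it).  CONVERSION: given `s₀ = s(t₁) u₁ ∈ B₀`, take the window `U″ := U′ ∩ {b ∈ T̃ | N b ∈ O}` with `O` the separation window of ★ part 2a at `t₁`; `U″` is open (`N` continuous),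
  contains `s₀` (`N(s t u) = ι t`), `Ψ` is injective on `(A₀ × U″) ∩ D`, a Borel `V′ ⊆ U″ ∩ B₀` is the disjoint union of its sheets `s(V_u) u` with `V_u := {t ∈ T^{reg} | s t · u ∈ V′}`
  Borel and `s(V_u)·u ⊆ V′ ⊆ U′`, so (3′) applies on every sheet with the SAME `A₀`; the tubes over distinct sheets are disjoint (injectivity) and Borel (★
  `measurableSet_image_inter_of_locallyInjOn`), so `νGt(Ψ(A₀ × V′)) = Σ_u μ₀(A₀) ∫⁻_{V_u} D_T`, while `∫⁻_{V′} Wt dλ = Σ_u ∫⁻_{V_u} D_T dt_T` (part 1 `lintegral_sheetMeasure` + `hWt`).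
* §2′ THE BOCHNER RADIAL IDENTITY ON `B₀` under (3′) (★ M2♭ §2 `integrable_and_integral_eq_of_tubeJacobian_local` with part 2a's (LI), (FC), continuity∕equivariance and §1′): for
  `g : G̃_v → E` `νGt`-integrable on the tube `Ψ(D)`, `(b, q) ↦ g(Ψ(q, b))` is integrable for `((λ|_{B₀}) · Wt) ⊗ μ₀` and
  **`∫_{b ∈ B₀} Wt(b) • ∫_{G̃_v ⧸ T′} g(Ψ(q, b)) dμ₀(q) dλ(b) = w_T • ∫_{Ψ(D)} g dνGt`**.
Part 3 (`R90S4TwistedTubeFormula`, R90-C131-p03) and (B1-Σ) consume §2′ (one binder `hJacL`, hypothesis-first).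

[cite: Rogawski1990, §12.5 p. 186; §3.11 Prop. 3.11.2 pp. 34–35; §4.3 p. 43] [cite: HarishChandra1970, Lemma 22; Lemma 42] [cite: Federer1969, §2.10.10]
-/

set_option autoImplicit false
-- the mandated namespace repeats the single-problem summit's segment (`HodgeConjecture.HodgeConjecture`)
set_option linter.dupNamespace false

noncomputable section

open MeasureTheory Measure Set Filter Topology Function NumberField IsDedekindDomain
open scoped ENNReal NNReal MatrixGroups Pointwise

namespace Summit.HodgeConjecture.HodgeConjecture.R90.S4

open Literature.NumberTheory.Rogawski1990 Literature.NumberTheory.Rogawski1990.Ch4Sec10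
open Literature.NumberTheory.Automorphic Literature.NumberTheory.Automorphic.UnitaryGroup
open Literature.MeasureTheory.Group
open Summit.HodgeConjecture.HodgeConjecture.Cruxes.H413.F0P3cStCharTSWeylCartanRadial

section RadialLoc

variable {L : Type} [Field L] [NumberField L] [IsCMField L] {v : HeightOneSpectrum (𝓞 ↥(maximalRealSubfield L))}
  (hns : ∀ w : PlacesOver L v, IsCMField.complexConj L • w.1 = w.1)
  {T : Subgroup ((UnitaryGroup.cmDatum L 3 (splitFormGL L : Matrix (Fin 3) (Fin 3) L)).Local v)}
  {γ₀ : (UnitaryGroup.cmDatum L 3 (splitFormGL L : Matrix (Fin 3) (Fin 3) L)).Local v} (hγ₀ : IsRegularElt (γ₀.val : GtLoc L v))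
  (hT : T = Subgroup.centralizer ({γ₀} : Set ((UnitaryGroup.cmDatum L 3 (splitFormGL L : Matrix (Fin 3) (Fin 3) L)).Local v)))
  [LocallyCompactSpace (GtLoc L v)] [SecondCountableTopology (GtLoc L v)] [T2Space (GtLoc L v)] [MeasurableSpace (GtLoc L v)] [BorelSpace (GtLoc L v)]
  [∀ δ : GtLoc L v, MeasurableSpace (GtLoc L v ⧸ epsCentralizer (epsLoc L (splitFormGL L) v) δ)]
  [∀ δ : GtLoc L v, BorelSpace (GtLoc L v ⧸ epsCentralizer (epsLoc L (splitFormGL L) v) δ)]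
  [MeasurableSpace ((UnitaryGroup.cmDatum L 3 (splitFormGL L : Matrix (Fin 3) (Fin 3) L)).Local v)] [BorelSpace ((UnitaryGroup.cmDatum L 3 (splitFormGL L : Matrix (Fin 3) (Fin 3) L)).Local v)]
  {δ₀ : GtLoc L v} (hδ₀T : δ₀ ∈ Subgroup.centralizer ({(γ₀.val : GtLoc L v)} : Set (GtLoc L v))) (hδ₀reg : IsEpsRegularAt L (splitFormGL L) v δ₀)
  (Ψ : (GtLoc L v ⧸ epsCentralizer (epsLoc L (splitFormGL L) v) δ₀) × ↥(Subgroup.centralizer ({(γ₀.val : GtLoc L v)} : Set (GtLoc L v))) → GtLoc L v)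
  (hΨ : ∀ (x : GtLoc L v) (b : ↥(Subgroup.centralizer ({(γ₀.val : GtLoc L v)} : Set (GtLoc L v)))), Ψ (QuotientGroup.mk x, b) = x * b * (epsLoc L (splitFormGL L) v x)⁻¹)
  (N' : Subgroup (GtLoc L v))
  (hN' : ∀ m, m ∈ N' ↔ m ∈ Subgroup.normalizer ((Subgroup.centralizer ({(γ₀.val : GtLoc L v)} : Set (GtLoc L v)) : Subgroup (GtLoc L v)) : Set (GtLoc L v)) ∧
    m * (epsLoc L (splitFormGL L) v m)⁻¹ ∈ Subgroup.centralizer ({(γ₀.val : GtLoc L v)} : Set (GtLoc L v)))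
  (s : ↥T → ↥(Subgroup.centralizer ({(γ₀.val : GtLoc L v)} : Set (GtLoc L v)))) (hsm : Measurable s)
  (hsN : ∀ t : ↥T, epsNorm (epsLoc L (splitFormGL L) v) (s t : GtLoc L v) = ((t : (UnitaryGroup.cmDatum L 3 (splitFormGL L : Matrix (Fin 3) (Fin 3) L)).Local v)).val)
  (R : Finset ↥(Subgroup.centralizer ({(γ₀.val : GtLoc L v)} : Set (GtLoc L v))))
  (hRN : ∀ u ∈ R, epsNorm (epsLoc L (splitFormGL L) v) (u : GtLoc L v) = 1)
  (hRcov : ∀ w : ↥(Subgroup.centralizer ({(γ₀.val : GtLoc L v)} : Set (GtLoc L v))), epsNorm (epsLoc L (splitFormGL L) v) (w : GtLoc L v) = 1 →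
    ∃ u ∈ R, ∃ a : ↥(Subgroup.centralizer ({(γ₀.val : GtLoc L v)} : Set (GtLoc L v))), (w : GtLoc L v) = u * (a * (epsLoc L (splitFormGL L) v a)⁻¹))
  (hRinj : ∀ u ∈ R, ∀ u' ∈ R, (∃ a : ↥(Subgroup.centralizer ({(γ₀.val : GtLoc L v)} : Set (GtLoc L v))),
    ((u' : ↥(Subgroup.centralizer ({(γ₀.val : GtLoc L v)} : Set (GtLoc L v)))) : GtLoc L v) = u * (a * (epsLoc L (splitFormGL L) v a)⁻¹)) → u = u')
  (tT : Measure ↥T) [SigmaFinite tT]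
  (Wt : ↥(Subgroup.centralizer ({(γ₀.val : GtLoc L v)} : Set (GtLoc L v))) → ℝ≥0) (hWtm : Measurable Wt)
  (hWt : ∀ t : ↥T, ∀ u ∈ R, Wt (s t * u) = cartanWeight L v T t)
  (τ' : Measure ↥(epsCentralizer (epsLoc L (splitFormGL L) v) δ₀)) [τ'.IsHaarMeasure] [τ'.IsInvInvariant]

/-! ## §1′ The local Jacobian letter (3′) ⇒ ★ M2♭'s local tube Jacobian over the sheeted transversal -/

set_option maxHeartbeats 800000 in
-- instance-term unification on the CM local carrier (`G̃_v ⧸ T′`, `quotientMeasure`), as in ★ (E1b) `F0P3cStCharTSWeylCartanJacobian` and part 2b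
omit [SigmaFinite tT] in
include hns hγ₀ hT hδ₀T hδ₀reg hΨ hN' hsm hsN hRN hRinj hWtm hWt in
/-- **(3′) LOCAL LETTER ⇒ ★ M2♭'s LOCAL TUBE JACOBIAN over `S = T̃`, `S₀ = B₀`, `lam = Σ_u (t ↦ s t · u)_*(t_T|_{T^{reg}})`, `W = Wt`.**  THE LETTER `hJacL` (bytes of record, R90 bus S4-R58):
for every `b₁ ∈ B₀` an open `U′ ∋ b₁` in `T̃` and a Borel `A₀ ⊆ G̃_v ⧸ T′` with `0 < μ₀(A₀) < ⊤` such that for EVERY sheet `u ∈ R` and every Borel `V ⊆ T^{reg}` with `s(V)·u ⊆ U′`: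
`νGt(Ψ(A₀ × s(V)·u)) = μ₀(A₀) · ∫⁻_V D_T dt_T`.  CONCLUSION: ★ M2♭'s `hJac` at every `s₀ ∈ B₀` (SAME bytes as part 2b §1), on the window `U″ = U′ ∩ N⁻¹(O)` (`O` = part 2a's separation
window at `t₁`), with injectivity on `(A₀ × U″) ∩ D` from part 2a and the measure identity summed over the (disjoint, Borel) tubes of the sheets of `V′`.
[cite: Rogawski1990, §12.5 p. 186] [cite: HarishChandra1970, Lemma 22; Lemma 42] [cite: Federer1969, §2.10.10] -/
theorem hJac_local_to_radial (νGt : Measure (GtLoc L v)) [νGt.IsHaarMeasure] [νGt.IsMulRightInvariant]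
    (hJacL : ∀ b₁ ∈ {b : ↥(Subgroup.centralizer ({(γ₀.val : GtLoc L v)} : Set (GtLoc L v))) | ∃ t : ↥T, IsRegularElt (((t : (UnitaryGroup.cmDatum L 3 (splitFormGL L : Matrix (Fin 3) (Fin 3) L)).Local v)).val : GtLoc L v) ∧ ∃ u ∈ R, b = s t * u},
      ∃ U' : Set ↥(Subgroup.centralizer ({(γ₀.val : GtLoc L v)} : Set (GtLoc L v))), IsOpen U' ∧ b₁ ∈ U' ∧
      ∃ A₀ : Set (GtLoc L v ⧸ epsCentralizer (epsLoc L (splitFormGL L) v) δ₀), MeasurableSet A₀ ∧ (quotientMeasure (epsCentralizer (epsLoc L (splitFormGL L) v) δ₀) τ' (isClosed_epsCentralizer L (splitFormGL L) v δ₀) νGt) A₀ ≠ 0 ∧ (quotientMeasure (epsCentralizer (epsLoc L (splitFormGL L) v) δ₀) τ' (isClosed_epsCentralizer L (splitFormGL L) v δ₀) νGt) A₀ ≠ ⊤ ∧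
        ∀ u ∈ R, ∀ V : Set ↥T, MeasurableSet V → V ⊆ {t : ↥T | IsRegularElt (((t : (UnitaryGroup.cmDatum L 3 (splitFormGL L : Matrix (Fin 3) (Fin 3) L)).Local v)).val : GtLoc L v)} →
          (fun t : ↥T => s t * u) '' V ⊆ U' →
          νGt (Ψ '' (A₀ ×ˢ ((fun t : ↥T => s t * u) '' V))) = (quotientMeasure (epsCentralizer (epsLoc L (splitFormGL L) v) δ₀) τ' (isClosed_epsCentralizer L (splitFormGL L) v δ₀) νGt) A₀ * ∫⁻ t in V, (cartanWeight L v T t : ℝ≥0∞) ∂tT) :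
    ∀ s₀ ∈ {b : ↥(Subgroup.centralizer ({(γ₀.val : GtLoc L v)} : Set (GtLoc L v))) | ∃ t : ↥T, IsRegularElt (((t : (UnitaryGroup.cmDatum L 3 (splitFormGL L : Matrix (Fin 3) (Fin 3) L)).Local v)).val : GtLoc L v) ∧ ∃ u ∈ R, b = s t * u},
      ∃ U' : Set ↥(Subgroup.centralizer ({(γ₀.val : GtLoc L v)} : Set (GtLoc L v))), IsOpen U' ∧ s₀ ∈ U' ∧
      ∃ A₀ : Set (GtLoc L v ⧸ epsCentralizer (epsLoc L (splitFormGL L) v) δ₀), MeasurableSet A₀ ∧ (quotientMeasure (epsCentralizer (epsLoc L (splitFormGL L) v) δ₀) τ' (isClosed_epsCentralizer L (splitFormGL L) v δ₀) νGt) A₀ ≠ 0 ∧ (quotientMeasure (epsCentralizer (epsLoc L (splitFormGL L) v) δ₀) τ' (isClosed_epsCentralizer L (splitFormGL L) v δ₀) νGt) A₀ ≠ ⊤ ∧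
        InjOn Ψ ((A₀ ×ˢ U') ∩ {p | p.2 ∈ {b : ↥(Subgroup.centralizer ({(γ₀.val : GtLoc L v)} : Set (GtLoc L v))) | ∃ t : ↥T, IsRegularElt (((t : (UnitaryGroup.cmDatum L 3 (splitFormGL L : Matrix (Fin 3) (Fin 3) L)).Local v)).val : GtLoc L v) ∧ ∃ u ∈ R, b = s t * u}}) ∧
        ∀ V' : Set ↥(Subgroup.centralizer ({(γ₀.val : GtLoc L v)} : Set (GtLoc L v))), MeasurableSet V' → V' ⊆ U' ∩ {b : ↥(Subgroup.centralizer ({(γ₀.val : GtLoc L v)} : Set (GtLoc L v))) | ∃ t : ↥T, IsRegularElt (((t : (UnitaryGroup.cmDatum L 3 (splitFormGL L : Matrix (Fin 3) (Fin 3) L)).Local v)).val : GtLoc L v) ∧ ∃ u ∈ R, b = s t * u} →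
          νGt (Ψ '' (A₀ ×ˢ V')) = (quotientMeasure (epsCentralizer (epsLoc L (splitFormGL L) v) δ₀) τ' (isClosed_epsCentralizer L (splitFormGL L) v δ₀) νGt) A₀ * ∫⁻ b in V', (Wt b : ℝ≥0∞) ∂(∑ u ∈ R, Measure.map (fun t : ↥T => s t * u) (tT.restrict {t : ↥T | IsRegularElt (((t : (UnitaryGroup.cmDatum L 3 (splitFormGL L : Matrix (Fin 3) (Fin 3) L)).Local v)).val : GtLoc L v)})) := by
  classical
  have hΦ := splitFormGL_isHermitian L
  -- uniqueness of the sheet decomposition of a point of `B₀` (no `set`∕`let` abbreviations for carriers: they cost the heartbeat budget at `whnf`)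
  have huniq : ∀ (t t' : ↥T) (u u' : ↥(Subgroup.centralizer ({(γ₀.val : GtLoc L v)} : Set (GtLoc L v)))), u ∈ R → u' ∈ R → s t * u = s t' * u' → t = t' ∧ u = u' := by
    intro t t' u u' hu hu' h
    have hN := epsNorm_sheet hγ₀ s hsN R hRN t u hu
    have hN' := epsNorm_sheet hγ₀ s hsN R hRN t' u' hu'
    rw [h] at hN
    have htt : t = t' := Subtype.ext (Subtype.ext (hN.symm.trans hN'))
    subst htt
    exact ⟨rfl, mul_left_cancel h⟩
  intro s₀ hs₀
  obtain ⟨t₁, ht₁, u₁, hu₁, rfl⟩ := hs₀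
  obtain ⟨U₁, hU₁o, hs₀U₁, A₀, hA₀m, hA₀0, hA₀top, hJ⟩ := hJacL (s t₁ * u₁) ⟨t₁, ht₁, u₁, hu₁, rfl⟩
  -- the window: the letter's `U′` cut by part 2a's separation window `O` at `t₁` read through the norm
  obtain ⟨O, hOo, ht₁O, hinjO⟩ := exists_normWindow_injOn_epsTube hns hγ₀ hT hδ₀T hδ₀reg Ψ hΨ N' hN' s hsN R hRN hRinj t₁ ht₁
  have hNo : IsOpen ((fun b : ↥(Subgroup.centralizer ({(γ₀.val : GtLoc L v)} : Set (GtLoc L v))) => epsNorm (epsLoc L (splitFormGL L) v) (b : GtLoc L v)) ⁻¹' O) :=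
    hOo.preimage (continuous_subtype_val.mul ((continuous_epsLoc L (splitFormGL L) v).comp continuous_subtype_val))
  have hsN' : ∀ t : ↥T, ∀ u ∈ R, s t * u ∈ (fun b : ↥(Subgroup.centralizer ({(γ₀.val : GtLoc L v)} : Set (GtLoc L v))) => epsNorm (epsLoc L (splitFormGL L) v) (b : GtLoc L v)) ⁻¹' O ↔
      (((t : (UnitaryGroup.cmDatum L 3 (splitFormGL L : Matrix (Fin 3) (Fin 3) L)).Local v)).val : GtLoc L v) ∈ O := fun t u hu => by
    rw [mem_preimage, epsNorm_sheet hγ₀ s hsN R hRN t u hu]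
  -- injectivity on the patch, from the separation window
  have hinjP : InjOn Ψ ((A₀ ×ˢ (U₁ ∩ (fun b : ↥(Subgroup.centralizer ({(γ₀.val : GtLoc L v)} : Set (GtLoc L v))) => epsNorm (epsLoc L (splitFormGL L) v) (b : GtLoc L v)) ⁻¹' O)) ∩ {p | p.2 ∈ {b : ↥(Subgroup.centralizer ({(γ₀.val : GtLoc L v)} : Set (GtLoc L v))) | ∃ t : ↥T, IsRegularElt (((t : (UnitaryGroup.cmDatum L 3 (splitFormGL L : Matrix (Fin 3) (Fin 3) L)).Local v)).val : GtLoc L v) ∧ ∃ u ∈ R, b = s t * u}}) := by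
    refine hinjO.mono ?_
    rintro ⟨q, b⟩ ⟨⟨-, hb⟩, hbB⟩
    exact ⟨⟨mem_univ _, hb.2⟩, hbB⟩
  refine ⟨U₁ ∩ (fun b : ↥(Subgroup.centralizer ({(γ₀.val : GtLoc L v)} : Set (GtLoc L v))) => epsNorm (epsLoc L (splitFormGL L) v) (b : GtLoc L v)) ⁻¹' O, hU₁o.inter hNo, ⟨hs₀U₁, (hsN' t₁ u₁ hu₁).2 ht₁O⟩,
    A₀, hA₀m, hA₀0, hA₀top, hinjP, fun V' hV'm hV'sub => ?_⟩
  -- the sheets of `V′`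
  let Vu : ↥(Subgroup.centralizer ({(γ₀.val : GtLoc L v)} : Set (GtLoc L v))) → Set ↥T := fun u => (fun t : ↥T => s t * u) ⁻¹' V' ∩ {t : ↥T | IsRegularElt (((t : (UnitaryGroup.cmDatum L 3 (splitFormGL L : Matrix (Fin 3) (Fin 3) L)).Local v)).val : GtLoc L v)}
  have hVum : ∀ u, MeasurableSet (Vu u) := fun u => by
    obtain ⟨w⟩ := (inferInstance : Nonempty (PlacesOver L v))
    have hregm : MeasurableSet {t : ↥T | IsRegularElt (((t : (UnitaryGroup.cmDatum L 3 (splitFormGL L : Matrix (Fin 3) (Fin 3) L)).Local v)).val : GtLoc L v)} :=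
      ((isOpen_setOf_isRegularElt_cmDatum_local (L := L) (H := (splitFormGL L : Matrix (Fin 3) (Fin 3) L)) (v := v) w (hns w)).preimage continuous_subtype_val).measurableSet
    exact ((hsm.mul_const u) hV'm).inter hregm
  have hVusub : ∀ u, Vu u ⊆ {t : ↥T | IsRegularElt (((t : (UnitaryGroup.cmDatum L 3 (splitFormGL L : Matrix (Fin 3) (Fin 3) L)).Local v)).val : GtLoc L v)} := fun u t ht => ht.2
  have hVuU : ∀ u, (fun t : ↥T => s t * u) '' Vu u ⊆ U₁ := by
    rintro u _ ⟨t, ht, rfl⟩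
    exact (hV'sub ht.1).1.1
  -- every point of `V′` lies on exactly one sheet over `T^{reg}`
  have hmemV' : ∀ b, b ∈ V' ↔ ∃ u ∈ R, ∃ t ∈ Vu u, b = s t * u := by
    intro b
    constructor
    · intro hb
      obtain ⟨-, t, ht, u, hu, rfl⟩ := hV'sub hb
      exact ⟨u, hu, t, ⟨hb, ht⟩, rfl⟩
    · rintro ⟨u, -, t, ht, rfl⟩
      exact ht.1
  have hV'eq : V' = ⋃ u ∈ R, (fun t : ↥T => s t * u) '' Vu u := by
    ext b
    rw [hmemV']
    simp only [mem_iUnion, mem_image, exists_prop]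
    constructor
    · rintro ⟨u, hu, t, ht, rfl⟩; exact ⟨u, hu, t, ht, rfl⟩
    · rintro ⟨u, hu, t, ht, rfl⟩; exact ⟨u, hu, t, ht, rfl⟩
  have htube : Ψ '' (A₀ ×ˢ V') = ⋃ u ∈ R, Ψ '' (A₀ ×ˢ ((fun t : ↥T => s t * u) '' Vu u)) := by
    rw [hV'eq]
    ext y
    simp only [mem_image, mem_prod, mem_iUnion, exists_prop, Prod.exists]
    constructor
    · rintro ⟨q, b, ⟨hq, u, hu, t, ht, rfl⟩, rfl⟩
      exact ⟨u, hu, q, s t * u, ⟨hq, t, ht, rfl⟩, rfl⟩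
    · rintro ⟨u, hu, q, b, ⟨hq, t, ht, rfl⟩, rfl⟩
      exact ⟨q, s t * u, ⟨hq, u, hu, t, ht, rfl⟩, rfl⟩
  have hsheetB₀ : ∀ u ∈ R, ∀ t ∈ Vu u, s t * u ∈ {b : ↥(Subgroup.centralizer ({(γ₀.val : GtLoc L v)} : Set (GtLoc L v))) | ∃ t : ↥T, IsRegularElt (((t : (UnitaryGroup.cmDatum L 3 (splitFormGL L : Matrix (Fin 3) (Fin 3) L)).Local v)).val : GtLoc L v) ∧ ∃ u ∈ R, b = s t * u} :=
    fun u hu t ht => ⟨t, ht.2, u, hu, rfl⟩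
  have hsheetW : ∀ u ∈ R, ∀ t ∈ Vu u, s t * u ∈ U₁ ∩ (fun b : ↥(Subgroup.centralizer ({(γ₀.val : GtLoc L v)} : Set (GtLoc L v))) => epsNorm (epsLoc L (splitFormGL L) v) (b : GtLoc L v)) ⁻¹' O :=
    fun u hu t ht => (hV'sub ht.1).1
  -- Borel structure
  have hTtcl : IsClosed ((Subgroup.centralizer ({(γ₀.val : GtLoc L v)} : Set (GtLoc L v)) : Subgroup (GtLoc L v)) : Set (GtLoc L v)) :=
    Set.isClosed_centralizer _
  haveI : LocallyCompactSpace ↥(Subgroup.centralizer ({(γ₀.val : GtLoc L v)} : Set (GtLoc L v))) := hTtcl.isClosedEmbedding_subtypeVal.locallyCompactSpace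
  haveI : PolishSpace ((GtLoc L v ⧸ epsCentralizer (epsLoc L (splitFormGL L) v) δ₀) × ↥(Subgroup.centralizer ({(γ₀.val : GtLoc L v)} : Set (GtLoc L v)))) :=
    polishSpace_quotient_prod_param (epsCentralizer (epsLoc L (splitFormGL L) v) δ₀) (isClosed_epsCentralizer L (splitFormGL L) v δ₀)
  have hB₀m : MeasurableSet {b : ↥(Subgroup.centralizer ({(γ₀.val : GtLoc L v)} : Set (GtLoc L v))) | ∃ t : ↥T, IsRegularElt (((t : (UnitaryGroup.cmDatum L 3 (splitFormGL L : Matrix (Fin 3) (Fin 3) L)).Local v)).val : GtLoc L v) ∧ ∃ u ∈ R, b = s t * u} :=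
    measurableSet_sheetTransversal hγ₀ hT s hsN R hRN hns hsm
  have hDm : MeasurableSet {p : (GtLoc L v ⧸ epsCentralizer (epsLoc L (splitFormGL L) v) δ₀) × ↥(Subgroup.centralizer ({(γ₀.val : GtLoc L v)} : Set (GtLoc L v))) | p.2 ∈ {b : ↥(Subgroup.centralizer ({(γ₀.val : GtLoc L v)} : Set (GtLoc L v))) | ∃ t : ↥T, IsRegularElt (((t : (UnitaryGroup.cmDatum L 3 (splitFormGL L : Matrix (Fin 3) (Fin 3) L)).Local v)).val : GtLoc L v) ∧ ∃ u ∈ R, b = s t * u}} := measurable_snd hB₀m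
  have hΨc : Continuous Ψ := (epsTube_smul_and_continuous Ψ hΨ).2
  have hLI := exists_isOpen_injOn_epsTube hns hγ₀ hδ₀T hδ₀reg Ψ hΨ N' hN' s hsN R hRN hRinj
  haveI : LocallyCompactSpace ((UnitaryGroup.cmDatum L 3 (splitFormGL L : Matrix (Fin 3) (Fin 3) L)).Local v) :=
    locallyCompactSpace_cmDatum_local (L := L) (N := 3) (H := (splitFormGL L : Matrix (Fin 3) (Fin 3) L)) (v := v)
  haveI : SecondCountableTopology (GL (Fin 3) (LocalRing L v)) := secondCountableTopology_localGL (E := L) 3 v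
  haveI : SecondCountableTopology ((UnitaryGroup.cmDatum L 3 (splitFormGL L : Matrix (Fin 3) (Fin 3) L)).Local v) := TopologicalSpace.Subtype.secondCountableTopology _
  haveI : PolishSpace ((UnitaryGroup.cmDatum L 3 (splitFormGL L : Matrix (Fin 3) (Fin 3) L)).Local v) :=
    Literature.Topology.Metrizable.polishSpace_of_locallyCompactSpace_of_secondCountableTopology _
  have hTcl : IsClosed (T : Set ((UnitaryGroup.cmDatum L 3 (splitFormGL L : Matrix (Fin 3) (Fin 3) L)).Local v)) := by
    rw [hT]; exact Set.isClosed_centralizer _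
  haveI : PolishSpace ↥T := hTcl.polishSpace
  have hsheetm : ∀ u ∈ R, MeasurableSet ((fun t : ↥T => s t * u) '' Vu u) := fun u hu =>
    (hVum u).image_of_measurable_injOn (hsm.mul_const u) (injective_sheet hγ₀ s hsN R hRN u hu).injOn
  have htubem : ∀ u ∈ R, MeasurableSet (Ψ '' (A₀ ×ˢ ((fun t : ↥T => s t * u) '' Vu u))) := by
    intro u hu
    have hsub : A₀ ×ˢ ((fun t : ↥T => s t * u) '' Vu u) ⊆ {p : (GtLoc L v ⧸ epsCentralizer (epsLoc L (splitFormGL L) v) δ₀) × ↥(Subgroup.centralizer ({(γ₀.val : GtLoc L v)} : Set (GtLoc L v))) | p.2 ∈ {b : ↥(Subgroup.centralizer ({(γ₀.val : GtLoc L v)} : Set (GtLoc L v))) | ∃ t : ↥T, IsRegularElt (((t : (UnitaryGroup.cmDatum L 3 (splitFormGL L : Matrix (Fin 3) (Fin 3) L)).Local v)).val : GtLoc L v) ∧ ∃ u ∈ R, b = s t * u}} := by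
      rintro ⟨q, b⟩ ⟨-, t, ht, rfl⟩; exact hsheetB₀ u hu t ht
    rw [← inter_eq_left.2 hsub]
    exact measurableSet_image_inter_of_locallyInjOn hDm hΨc (fun z _ => hLI z) (hA₀m.prod (hsheetm u hu))
  -- the tubes over distinct sheets are disjoint (injectivity patch + uniqueness of the sheet decomposition)
  have hdisj : (↑R : Set ↥(Subgroup.centralizer ({(γ₀.val : GtLoc L v)} : Set (GtLoc L v)))).PairwiseDisjoint fun u => Ψ '' (A₀ ×ˢ ((fun t : ↥T => s t * u) '' Vu u)) := by
    intro u hu u' hu' hne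
    refine Set.disjoint_left.2 fun y hy hy' => hne ?_
    obtain ⟨⟨q, b⟩, ⟨hq, t, ht, rfl⟩, rfl⟩ := hy
    obtain ⟨⟨q', b'⟩, ⟨hq', t', ht', rfl⟩, hyy⟩ := hy'
    have h1 : ((q', s t' * u') : (GtLoc L v ⧸ epsCentralizer (epsLoc L (splitFormGL L) v) δ₀) × ↥(Subgroup.centralizer ({(γ₀.val : GtLoc L v)} : Set (GtLoc L v)))) = (q, s t * u) :=
      hinjP ⟨⟨hq', hsheetW u' hu' t' ht'⟩, hsheetB₀ u' hu' t' ht'⟩ ⟨⟨hq, hsheetW u hu t ht⟩, hsheetB₀ u hu t ht⟩ hyy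
    have h2 : s t' * u' = s t * u := congrArg Prod.snd h1
    exact ((huniq t' t u' u hu' hu h2).2).symm
  -- left side: additivity over the sheets and the local letter on each sheet (same `A₀`, sheets inside `U′`)
  have hL : νGt (Ψ '' (A₀ ×ˢ V')) = ∑ u ∈ R, (quotientMeasure (epsCentralizer (epsLoc L (splitFormGL L) v) δ₀) τ' (isClosed_epsCentralizer L (splitFormGL L) v δ₀) νGt) A₀ * ∫⁻ t in Vu u, (cartanWeight L v T t : ℝ≥0∞) ∂tT := by
    rw [htube, measure_biUnion_finset hdisj (fun u hu => htubem u hu)]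
    exact Finset.sum_congr rfl fun u hu => hJ u hu (Vu u) (hVum u) (hVusub u) (hVuU u)
  -- right side: the sheet measure unpacked (part 1 `lintegral_sheetMeasure`) and the weight read through the sheets
  have hR' : ∫⁻ b in V', (Wt b : ℝ≥0∞) ∂(∑ u ∈ R, Measure.map (fun t : ↥T => s t * u) (tT.restrict {t : ↥T | IsRegularElt (((t : (UnitaryGroup.cmDatum L 3 (splitFormGL L : Matrix (Fin 3) (Fin 3) L)).Local v)).val : GtLoc L v)})) =
      ∑ u ∈ R, ∫⁻ t in Vu u, (cartanWeight L v T t : ℝ≥0∞) ∂tT := by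
    rw [← lintegral_indicator hV'm, lintegral_sheetMeasure s R hsm (tT.restrict {t : ↥T | IsRegularElt (((t : (UnitaryGroup.cmDatum L 3 (splitFormGL L : Matrix (Fin 3) (Fin 3) L)).Local v)).val : GtLoc L v)}) ((hWtm.coe_nnreal_ennreal).indicator hV'm)]
    refine Finset.sum_congr rfl fun u hu => ?_
    have hind : ∀ t : ↥T, V'.indicator (fun b => (Wt b : ℝ≥0∞)) (s t * u) =
        ((fun t : ↥T => s t * u) ⁻¹' V').indicator (fun t => (cartanWeight L v T t : ℝ≥0∞)) t := by
      intro t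
      by_cases ht : s t * u ∈ V'
      · rw [indicator_of_mem ht, indicator_of_mem (show t ∈ (fun t : ↥T => s t * u) ⁻¹' V' from ht), hWt t u hu]
      · rw [indicator_of_notMem ht, indicator_of_notMem (show t ∉ (fun t : ↥T => s t * u) ⁻¹' V' from ht)]
    simp only [hind]
    rw [lintegral_indicator ((hsm.mul_const u) hV'm), Measure.restrict_restrict ((hsm.mul_const u) hV'm)]
  rw [hL, hR', Finset.mul_sum]

/-! ## §2′ The Bochner radial identity over the sheeted transversal, under the local letter -/

set_option maxHeartbeats 400000 in
-- instance-term unification on the CM local carrier (`G̃_v ⧸ T′`, `quotientMeasure`), as in ★ (E1b) and part 2b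
include hns hγ₀ hT hδ₀T hδ₀reg hΨ hN' hsm hsN hRN hRcov hRinj hWtm hWt in
/-- **THE BOCHNER RADIAL IDENTITY ON `B₀` FOR THE ε-TWISTED TUBE OF `T`, UNDER THE LOCAL LETTER (3′)** (★ M2♭ §2 fed with part 2a's (LI), (FC), continuity∕equivariance and §1′): for every
`g : G̃_v → E` that is `νGt`-integrable on the tube `Ψ(D)`: `(b, q) ↦ g(Ψ(q, b))` is integrable for `((λ|_{B₀}) · Wt) ⊗ μ₀`, and
**`∫_{b ∈ B₀} Wt(b) • ∫_{G̃_v ⧸ T′} g(Ψ(q, b)) dμ₀(q) dλ(b) = [Ñ^ε_T : T̃] • ∫_{Ψ(D)} g dνGt`** — the twisted Weyl integration formula of ONE tube with its radial measure identified on the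
sheets; same conclusion bytes as part 2b §2, one binder changed (`hJac ↦ hJacL`). [cite: Rogawski1990, §12.5 p. 186] [cite: HarishChandra1970, Lemma 42] [cite: Federer1969, §2.10.10] -/
theorem integrable_and_integral_epsTube_eq_of_localJacobian (νGt : Measure (GtLoc L v)) [νGt.IsHaarMeasure] [νGt.IsMulRightInvariant]
    (hJacL : ∀ b₁ ∈ {b : ↥(Subgroup.centralizer ({(γ₀.val : GtLoc L v)} : Set (GtLoc L v))) | ∃ t : ↥T, IsRegularElt (((t : (UnitaryGroup.cmDatum L 3 (splitFormGL L : Matrix (Fin 3) (Fin 3) L)).Local v)).val : GtLoc L v) ∧ ∃ u ∈ R, b = s t * u},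
      ∃ U' : Set ↥(Subgroup.centralizer ({(γ₀.val : GtLoc L v)} : Set (GtLoc L v))), IsOpen U' ∧ b₁ ∈ U' ∧
      ∃ A₀ : Set (GtLoc L v ⧸ epsCentralizer (epsLoc L (splitFormGL L) v) δ₀), MeasurableSet A₀ ∧ (quotientMeasure (epsCentralizer (epsLoc L (splitFormGL L) v) δ₀) τ' (isClosed_epsCentralizer L (splitFormGL L) v δ₀) νGt) A₀ ≠ 0 ∧ (quotientMeasure (epsCentralizer (epsLoc L (splitFormGL L) v) δ₀) τ' (isClosed_epsCentralizer L (splitFormGL L) v δ₀) νGt) A₀ ≠ ⊤ ∧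
        ∀ u ∈ R, ∀ V : Set ↥T, MeasurableSet V → V ⊆ {t : ↥T | IsRegularElt (((t : (UnitaryGroup.cmDatum L 3 (splitFormGL L : Matrix (Fin 3) (Fin 3) L)).Local v)).val : GtLoc L v)} →
          (fun t : ↥T => s t * u) '' V ⊆ U' →
          νGt (Ψ '' (A₀ ×ˢ ((fun t : ↥T => s t * u) '' V))) = (quotientMeasure (epsCentralizer (epsLoc L (splitFormGL L) v) δ₀) τ' (isClosed_epsCentralizer L (splitFormGL L) v δ₀) νGt) A₀ * ∫⁻ t in V, (cartanWeight L v T t : ℝ≥0∞) ∂tT)    {E : Type*} [NormedAddCommGroup E] [NormedSpace ℝ E] (g : GtLoc L v → E)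
    (hg : IntegrableOn g (Ψ '' {p | p.2 ∈ {b : ↥(Subgroup.centralizer ({(γ₀.val : GtLoc L v)} : Set (GtLoc L v))) | ∃ t : ↥T, IsRegularElt (((t : (UnitaryGroup.cmDatum L 3 (splitFormGL L : Matrix (Fin 3) (Fin 3) L)).Local v)).val : GtLoc L v) ∧ ∃ u ∈ R, b = s t * u}}) νGt) :
    Integrable (fun p : ↥(Subgroup.centralizer ({(γ₀.val : GtLoc L v)} : Set (GtLoc L v))) × (GtLoc L v ⧸ epsCentralizer (epsLoc L (splitFormGL L) v) δ₀) => g (Ψ (p.2, p.1)))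
        (((((∑ u ∈ R, Measure.map (fun t : ↥T => s t * u) (tT.restrict {t : ↥T | IsRegularElt (((t : (UnitaryGroup.cmDatum L 3 (splitFormGL L : Matrix (Fin 3) (Fin 3) L)).Local v)).val : GtLoc L v)}))).restrict {b : ↥(Subgroup.centralizer ({(γ₀.val : GtLoc L v)} : Set (GtLoc L v))) | ∃ t : ↥T, IsRegularElt (((t : (UnitaryGroup.cmDatum L 3 (splitFormGL L : Matrix (Fin 3) (Fin 3) L)).Local v)).val : GtLoc L v) ∧ ∃ u ∈ R, b = s t * u}).withDensity fun b => (Wt b : ℝ≥0∞)).prod (quotientMeasure (epsCentralizer (epsLoc L (splitFormGL L) v) δ₀) τ' (isClosed_epsCentralizer L (splitFormGL L) v δ₀) νGt)) ∧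
      ∫ b in {b : ↥(Subgroup.centralizer ({(γ₀.val : GtLoc L v)} : Set (GtLoc L v))) | ∃ t : ↥T, IsRegularElt (((t : (UnitaryGroup.cmDatum L 3 (splitFormGL L : Matrix (Fin 3) (Fin 3) L)).Local v)).val : GtLoc L v) ∧ ∃ u ∈ R, b = s t * u}, (Wt b : ℝ) • ∫ q, g (Ψ (q, b)) ∂(quotientMeasure (epsCentralizer (epsLoc L (splitFormGL L) v) δ₀) τ' (isClosed_epsCentralizer L (splitFormGL L) v δ₀) νGt) ∂(∑ u ∈ R, Measure.map (fun t : ↥T => s t * u) (tT.restrict {t : ↥T | IsRegularElt (((t : (UnitaryGroup.cmDatum L 3 (splitFormGL L : Matrix (Fin 3) (Fin 3) L)).Local v)).val : GtLoc L v)})) =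
      ((((Subgroup.centralizer ({(γ₀.val : GtLoc L v)} : Set (GtLoc L v))).subgroupOf N').index : ℕ) : ℝ) •
        ∫ y in Ψ '' {p | p.2 ∈ {b : ↥(Subgroup.centralizer ({(γ₀.val : GtLoc L v)} : Set (GtLoc L v))) | ∃ t : ↥T, IsRegularElt (((t : (UnitaryGroup.cmDatum L 3 (splitFormGL L : Matrix (Fin 3) (Fin 3) L)).Local v)).val : GtLoc L v) ∧ ∃ u ∈ R, b = s t * u}}, g y ∂νGt := by
  classical
  have hΦ := splitFormGL_isHermitian L
  -- instances for ★ M2♭ at `B = T′`, `S = T̃`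
  have hTtcl : IsClosed ((Subgroup.centralizer ({(γ₀.val : GtLoc L v)} : Set (GtLoc L v)) : Subgroup (GtLoc L v)) : Set (GtLoc L v)) :=
    Set.isClosed_centralizer _
  haveI : LocallyCompactSpace ↥(Subgroup.centralizer ({(γ₀.val : GtLoc L v)} : Set (GtLoc L v))) := hTtcl.isClosedEmbedding_subtypeVal.locallyCompactSpace
  haveI : T1Space (GtLoc L v ⧸ epsCentralizer (epsLoc L (splitFormGL L) v) δ₀) := by
    haveI : IsClosed ((epsCentralizer (epsLoc L (splitFormGL L) v) δ₀ : Subgroup (GtLoc L v)) : Set (GtLoc L v)) :=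
      isClosed_epsCentralizer L (splitFormGL L) v δ₀
    infer_instance
  haveI : MeasurableSingletonClass (GtLoc L v ⧸ epsCentralizer (epsLoc L (splitFormGL L) v) δ₀) := ⟨fun x => isClosed_singleton.measurableSet⟩
  haveI : MeasurableSingletonClass ↥(Subgroup.centralizer ({(γ₀.val : GtLoc L v)} : Set (GtLoc L v))) := ⟨fun x => isClosed_singleton.measurableSet⟩
  -- the sheet measure is σ-finite (finite sum of push-forwards under measurable injections of the standard Borel `T`)
  haveI : LocallyCompactSpace ((UnitaryGroup.cmDatum L 3 (splitFormGL L : Matrix (Fin 3) (Fin 3) L)).Local v) :=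
    locallyCompactSpace_cmDatum_local (L := L) (N := 3) (H := (splitFormGL L : Matrix (Fin 3) (Fin 3) L)) (v := v)
  haveI : SecondCountableTopology (GL (Fin 3) (LocalRing L v)) := secondCountableTopology_localGL (E := L) 3 v
  haveI : SecondCountableTopology ((UnitaryGroup.cmDatum L 3 (splitFormGL L : Matrix (Fin 3) (Fin 3) L)).Local v) := TopologicalSpace.Subtype.secondCountableTopology _
  haveI : PolishSpace ((UnitaryGroup.cmDatum L 3 (splitFormGL L : Matrix (Fin 3) (Fin 3) L)).Local v) :=
    Literature.Topology.Metrizable.polishSpace_of_locallyCompactSpace_of_secondCountableTopology _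
  have hTcl : IsClosed (T : Set ((UnitaryGroup.cmDatum L 3 (splitFormGL L : Matrix (Fin 3) (Fin 3) L)).Local v)) := by
    rw [hT]; exact Set.isClosed_centralizer _
  haveI : PolishSpace ↥T := hTcl.polishSpace
  haveI : SigmaFinite (∑ u ∈ R, Measure.map (fun t : ↥T => s t * u) (tT.restrict {t : ↥T | IsRegularElt (((t : (UnitaryGroup.cmDatum L 3 (splitFormGL L : Matrix (Fin 3) (Fin 3) L)).Local v)).val : GtLoc L v)})) := by
    have hemb : ∀ u ∈ R, MeasurableEmbedding (fun t : ↥T => s t * u) := fun u hu =>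
      (hsm.mul_const u).measurableEmbedding (injective_sheet hγ₀ s hsN R hRN u hu)
    haveI : ∀ u : ↥R, SigmaFinite (Measure.map (fun t : ↥T => s t * (u : ↥(Subgroup.centralizer ({(γ₀.val : GtLoc L v)} : Set (GtLoc L v))))) (tT.restrict {t : ↥T | IsRegularElt (((t : (UnitaryGroup.cmDatum L 3 (splitFormGL L : Matrix (Fin 3) (Fin 3) L)).Local v)).val : GtLoc L v)})) :=
      fun u => (hemb u u.2).sigmaFinite_map
    rw [← Finset.sum_coe_sort, ← Measure.sum_fintype]
    infer_instance
  obtain ⟨hsmul, hcont⟩ := epsTube_smul_and_continuous Ψ hΨ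
  exact integrable_and_integral_eq_of_tubeJacobian_local (epsCentralizer (epsLoc L (splitFormGL L) v) δ₀) (isClosed_epsCentralizer L (splitFormGL L) v δ₀) νGt Ψ hcont
    (fun c : GtLoc L v => (epsLoc L (splitFormGL L) v c)⁻¹) hsmul _ (measurableSet_sheetTransversal hγ₀ hT s hsN R hRN hns hsm)
    (fun z _ => exists_isOpen_injOn_epsTube hns hγ₀ hδ₀T hδ₀reg Ψ hΨ N' hN' s hsN R hRN hRinj z) _
    (fun y hy => count_fibre_epsTube_eq hns hγ₀ hT hδ₀T hδ₀reg Ψ hΨ N' hN' s hsN R hRN hRcov hRinj hy) τ' _ Wt hWtm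
    (hJac_local_to_radial hns hγ₀ hT hδ₀T hδ₀reg Ψ hΨ N' hN' s hsm hsN R hRN hRinj tT Wt hWtm hWt τ' νGt hJacL) g hg

end RadialLoc

end Summit.HodgeConjecture.HodgeConjecture.R90.S4

end
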